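import Mathlib
import Literature.Analysis.PDE.GaussianBeam1DMajorant

/-!
# First-order Gaussian beams for `u_tt − u_xx + μ² q(x) u = 0`: the residual of the cut beam is
# `O(√μ)` pointwise on compact time intervals

Topic `Literature/Analysis/PDE` (namespace `Literature.Analysis.PDE`). Everything is proved; no
definitions.

`cutBeam_residual_pointwise`: let the μ-INDEPENDENT phase functions `X ξ θ Γ a` of a first-order
beam be `C²` and satisfy the six phase equations (`Literature.Analysis.ODE.exists_beamPhase`) with
`Im Γ > 0` and `|X′| ≤ 1`, let `q ∈ C³`, and let `χ ∈ C²` be a cut-off with `χ = 1` on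
`[−δ₀/2, δ₀/2]` and `χ = 0` on `{|y| ≥ δ₀}`. Then there is `B` such that for every `μ ≥ 1`,
`t ∈ [0, T]` and `x ∈ ℝ` the cut real beam `G_μ(t,x) = χ(x − X t)·Re(a(t)e^{iμΦ(t,x)})` satisfies

  `|∂_t²G_μ − ∂_x²G_μ + μ² q G_μ|(t, x) ≤ B √μ`.

The constant comes from sup norms on `[0, T]` of the phase functions and their first two
derivatives, from `inf_{[0,T]} Im Γ > 0`, from a bound on `q‴` on the `δ₀`-neighbourhood of the ray
and from `χ` (J. Ralston 1982, §2: first-order beams are `O(√μ)`-accurate pointwise, the beam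
itself having energy density `≍ μ²` on the width `μ^{−1/2}`; J. Sbierski 2015, §3, second lemma:
the cut-off costs only exponentially small terms). Ingredients: `cutBeam_residual_eq`,
`beam_re_residual`, `norm_beam_residual_le`, `abs_taylor_two_remainder_le`, the size lemmas of
`GaussianBeam1DCutoff.lean`, and compactness (`exists_norm_le_of_continuous_Icc`,
`exists_pos_le_of_continuous_Icc`).

## References

* J. Ralston, *Gaussian beams and the propagation of singularities*, MAA Stud. Math. 23 (1982)
  206–248, §2. Key `Ralston1982`.
* J. Sbierski, Anal. PDE 8 (2015) 1379–1420, §3 (arXiv:1311.2477v2 §2.3). Key `Sbierski2015`.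
-/

noncomputable section

namespace Literature.Analysis.PDE

open Set Filter Topology Complex

/-! ### The pointwise bound -/

section Pointwise

variable {q : ℝ → ℝ} {X ξ θ χ : ℝ → ℝ} {Γ a : ℝ → ℂ} {ω₀ δ₀ : ℝ}

set_option maxHeartbeats 1600000 in
/-- **The residual of the cut beam is `O(√μ)` pointwise on `[0, T]`.** See the module docstring.
(A long but elementary bookkeeping proof; the heartbeat budget is raised for it.)
[cite: Ralston1982, §2; Sbierski2015, §3 (arXiv §2.3, second lemma)] -/
theorem cutBeam_residual_pointwise (hq : ContDiff ℝ 3 q) (hω₀ : ω₀ ≠ 0)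
    (hX2 : ContDiff ℝ 2 X) (hξ2 : ContDiff ℝ 2 ξ) (hθ2 : ContDiff ℝ 2 θ) (hΓ2 : ContDiff ℝ 2 Γ)
    (ha2 : ContDiff ℝ 2 a)
    (hX : ∀ t, deriv X t = ξ t / ω₀) (hξ : ∀ t, deriv ξ t = -(deriv q (X t)) / (2 * ω₀))
    (hcons : ∀ t, ξ t ^ 2 + q (X t) = ω₀ ^ 2) (hθ : ∀ t, deriv θ t = -ω₀ + ξ t * deriv X t)
    (hΓ : ∀ t, (ω₀ : ℂ) * deriv Γ t
      = (((deriv ξ t : ℝ) : ℂ) - Γ t * ((deriv X t : ℝ) : ℂ)) ^ 2 - Γ t ^ 2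
        - ((iteratedDeriv 2 q (X t) / 2 : ℝ) : ℂ))
    (ha : ∀ t, 2 * (ω₀ : ℂ) * deriv a t
      = -((((deriv ξ t : ℝ) : ℂ) - Γ t * ((deriv X t : ℝ) : ℂ)) * ((deriv X t : ℝ) : ℂ) + Γ t) * a t)
    (hIm : ∀ t, 0 < (Γ t).im) (hX1 : ∀ t, |deriv X t| ≤ 1)
    (hχ : ContDiff ℝ 2 χ) (hδ₀ : 0 < δ₀) (hχ1 : ∀ y ∈ Icc (-(δ₀ / 2)) (δ₀ / 2), χ y = 1)
    (hχ0 : ∀ y, δ₀ ≤ |y| → χ y = 0) (T : ℝ) :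
    ∃ B : ℝ, 0 ≤ B ∧ ∀ μ : ℝ, 1 ≤ μ → ∀ t ∈ Icc 0 T, ∀ x : ℝ,
      let u : ℝ → ℝ → ℝ := fun t x => (a t * cexp (I * μ * ((θ t : ℂ)
        + (ξ t : ℂ) * ((x : ℂ) - X t) + Γ t / 2 * ((x : ℂ) - X t) ^ 2))).re
      |iteratedDeriv 2 (fun τ => χ (x - X τ) * u τ x) t
          - iteratedDeriv 2 (fun y => χ (y - X t) * u t y) x
          + μ ^ 2 * q x * (χ (x - X t) * u t x)| ≤ B * Real.sqrt μ := by
  /- (1) constants from compactness of `[0, T]` -/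
  have cR : Continuous fun r : ℝ => (r : ℂ) := Complex.continuous_ofReal
  obtain ⟨Ca, hCa0, hCa⟩ := exists_norm_le_of_continuous_Icc ha2.continuous 0 T
  obtain ⟨Ca1, hCa10, hCa1⟩ := exists_norm_le_of_continuous_Icc (ha2.continuous_deriv (by norm_num)) 0 T
  obtain ⟨Ca2, hCa20, hCa2⟩ := exists_norm_le_of_continuous_Icc
    ((ha2.deriv').continuous_deriv le_rfl) 0 T
  obtain ⟨CΓ, hCΓ0, hCΓ⟩ := exists_norm_le_of_continuous_Icc hΓ2.continuous 0 T
  obtain ⟨CΓ1, hCΓ10, hCΓ1⟩ := exists_norm_le_of_continuous_Icc (hΓ2.continuous_deriv (by norm_num)) 0 T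
  obtain ⟨CΓ2, hCΓ20, hCΓ2⟩ := exists_norm_le_of_continuous_Icc
    ((hΓ2.deriv').continuous_deriv le_rfl) 0 T
  obtain ⟨Cξ, hCξ0, hCξ⟩ := exists_norm_le_of_continuous_Icc hξ2.continuous 0 T
  obtain ⟨Cξ1, hCξ10, hCξ1⟩ := exists_norm_le_of_continuous_Icc (hξ2.continuous_deriv (by norm_num)) 0 T
  obtain ⟨Cξ2, hCξ20, hCξ2⟩ := exists_norm_le_of_continuous_Icc
    ((hξ2.deriv').continuous_deriv le_rfl) 0 T
  obtain ⟨CX2, hCX20, hCX2⟩ := exists_norm_le_of_continuous_Icc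
    ((hX2.deriv').continuous_deriv le_rfl) 0 T
  obtain ⟨Cθ1, hCθ10, hCθ1⟩ := exists_norm_le_of_continuous_Icc (hθ2.continuous_deriv (by norm_num)) 0 T
  obtain ⟨βm, hβm0, hβm⟩ := exists_pos_le_of_continuous_Icc
    (Complex.continuous_im.comp hΓ2.continuous) hIm 0 T
  -- the cut-off and its derivatives are bounded on the line
  obtain ⟨Cχ0', hCχ0'0, hCχ0'⟩ := exists_norm_le_of_continuous_Icc hχ.continuous (-δ₀) δ₀
  obtain ⟨Cχ1', hCχ1'0, hCχ1'⟩ := exists_norm_le_of_continuous_Icc (hχ.continuous_deriv (by norm_num)) (-δ₀) δ₀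
  obtain ⟨Cχ2', hCχ2'0, hCχ2'⟩ := exists_norm_le_of_continuous_Icc
    ((hχ.deriv').continuous_deriv le_rfl) (-δ₀) δ₀
  have habs_mem : ∀ {y : ℝ}, |y| ≤ δ₀ → y ∈ Icc (-δ₀) δ₀ := fun {y} hy =>
    ⟨by linarith only [neg_abs_le y, hy], (le_abs_self y).trans hy⟩
  have hCχ0 : ∀ y, |χ y| ≤ Cχ0' := fun y => by
    rcases le_or_gt |y| δ₀ with hy | hy
    · simpa [Real.norm_eq_abs] using hCχ0' y (habs_mem hy)
    · rw [hχ0 y hy.le, abs_zero]; exact hCχ0'0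
  have hCχ1 : ∀ y, |deriv χ y| ≤ Cχ1' := fun y => by
    rcases le_or_gt |y| δ₀ with hy | hy
    · simpa [Real.norm_eq_abs] using hCχ1' y (habs_mem hy)
    · rw [(cutoff_derivs_eq_zero hχ1 hχ0 (Or.inr hy)).1, abs_zero]; exact hCχ1'0
  have hCχ2 : ∀ y, |deriv (deriv χ) y| ≤ Cχ2' := fun y => by
    rcases le_or_gt |y| δ₀ with hy | hy
    · simpa [Real.norm_eq_abs] using hCχ2' y (habs_mem hy)
    · rw [(cutoff_derivs_eq_zero hχ1 hχ0 (Or.inr hy)).2, abs_zero]; exact hCχ2'0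
  -- `q‴` is bounded on the `δ₀`-neighbourhood of the ray over `[0, T]`
  set K : Set ℝ := (fun p : ℝ × ℝ => X p.1 + p.2) '' (Icc 0 T ×ˢ Icc (-δ₀) δ₀) with hK
  have hKc : IsCompact K := (isCompact_Icc.prod isCompact_Icc).image
    ((hX2.continuous.comp continuous_fst).add continuous_snd)
  obtain ⟨Cq3', hCq3'⟩ := hKc.exists_bound_of_continuousOn
    ((hq.continuous_iteratedDeriv 3 le_rfl).continuousOn (s := K))
  set Cq3 : ℝ := max Cq3' 0 with hCq3
  have hCq30 : 0 ≤ Cq3 := le_max_right _ _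
  have hq3K : ∀ z ∈ K, |iteratedDeriv 3 q z| ≤ Cq3 := fun z hz => by
    have h := hCq3' z hz
    rw [Real.norm_eq_abs] at h
    exact h.trans (le_max_left _ _)
  have hLip : ∀ t ∈ Icc 0 T, ∀ y : ℝ, |y| ≤ δ₀ →
      ∀ z ∈ uIcc (X t) (X t + y), |iteratedDeriv 2 q z - iteratedDeriv 2 q (X t)| ≤ Cq3 * |z - X t| := by
    intro t ht y hy z hz
    have hdiff : ∀ w ∈ uIcc (X t) (X t + y), DifferentiableAt ℝ (iteratedDeriv 2 q) w := fun w _ =>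
      (hq.differentiable_iteratedDeriv 2 (by norm_num)) w
    have hbound : ∀ w ∈ uIcc (X t) (X t + y), ‖deriv (iteratedDeriv 2 q) w‖ ≤ Cq3 := by
      intro w hw
      rw [← iteratedDeriv_succ, Real.norm_eq_abs]
      refine hq3K w ⟨(t, w - X t), ⟨ht, ?_⟩, by simp⟩
      have hw' : |w - X t| ≤ |y| := by
        have := abs_sub_left_of_mem_uIcc hw
        simpa using this
      exact habs_mem (hw'.trans hy)
    have h := Convex.norm_image_sub_le_of_norm_deriv_le hdiff hbound (convex_uIcc _ _)
      left_mem_uIcc hz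
    simpa [Real.norm_eq_abs] using h
  /- (2) the constant -/
  obtain ⟨CΦ, hCΦ⟩ : ∃ c : ℝ, c = Cθ1 + Cξ1 * δ₀ + Cξ + CΓ1 / 2 * δ₀ ^ 2 + CΓ * δ₀ := ⟨_, rfl⟩
  obtain ⟨Mstar, hMstar⟩ : ∃ c : ℝ, c = Ca * ((Cξ1 + CΓ) * CΓ1 + Cq3) * (16 / βm ^ 2 + 2 / βm) / 2
      + 4 * Ca * CΓ1 ^ 2 / βm ^ 2
      + (2 * (Cξ1 + CΓ) * Ca1 + (Cξ2 + 2 * CΓ1 + CΓ * CX2) * Ca) * (2 / βm + 1) / 2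
      + 2 * (CΓ1 * Ca1 + CΓ2 / 2 * Ca) / βm + Ca2 := ⟨_, rfl⟩
  obtain ⟨Ccross, hCcross⟩ : ∃ c : ℝ, c = (Cχ2' + CX2 * Cχ1' + Cχ2') * Ca
    + 2 * Cχ1' * (Ca1 + CΦ * Ca * (8 / (βm * δ₀ ^ 2)))
    + 2 * Cχ1' * ((Cξ + CΓ * δ₀) * Ca * (8 / (βm * δ₀ ^ 2))) := ⟨_, rfl⟩
  have hCΦ0 : 0 ≤ CΦ := by rw [hCΦ]; positivity
  have hMstar0 : 0 ≤ Mstar := by rw [hMstar]; positivity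
  have hCcross0 : 0 ≤ Ccross := by rw [hCcross]; positivity
  refine ⟨Cχ0' * Mstar + Ccross, by positivity, ?_⟩
  /- (3) the estimate -/
  intro μ hμ t ht x u
  have hμ0 : 0 ≤ μ := zero_le_one.trans hμ
  have hs1 : 1 ≤ Real.sqrt μ := Real.one_le_sqrt.2 hμ
  have hX1sq : deriv X t ^ 2 ≤ 1 := (sq_le_one_iff_abs_le_one _).2 (hX1 t)
  set y : ℝ := x - X t with hy
  set β : ℝ := (Γ t).im with hβdef
  have hβ : 0 < β := hIm t
  have hβm' : βm ≤ β := hβm t ht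
  set Gt : ℝ := Real.exp (-(μ * β * y ^ 2 / 2)) with hGt
  have hGt1 : Gt ≤ 1 := by
    rw [hGt, Real.exp_le_one_iff, neg_nonpos]; positivity
  have hGt0 : 0 ≤ Gt := (Real.exp_pos _).le
  have hGtm : Gt ≤ Real.exp (-(μ * βm * y ^ 2 / 2)) := by
    apply Real.exp_le_exp.2
    have : μ * βm * y ^ 2 / 2 ≤ μ * β * y ^ 2 / 2 := by gcongr
    linarith only [this]
  -- the formula for the residual of the cut beam
  have hform : iteratedDeriv 2 (fun τ => χ (x - X τ) * u τ x) t
        - iteratedDeriv 2 (fun y => χ (y - X t) * u t y) x + μ ^ 2 * q x * (χ (x - X t) * u t x)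
      = χ (x - X t) * (iteratedDeriv 2 (fun τ => u τ x) t - iteratedDeriv 2 (u t) x
          + μ ^ 2 * q x * u t x)
        + (deriv X t ^ 2 * iteratedDeriv 2 χ (x - X t) - deriv (deriv X) t * deriv χ (x - X t)
            - iteratedDeriv 2 χ (x - X t)) * u t x
        - 2 * (deriv X t * deriv χ (x - X t)) * deriv (fun τ => u τ x) t
        - 2 * deriv χ (x - X t) * deriv (u t) x :=
    cutBeam_residual_eq (μ := μ) (q := q) hχ hX2 hξ2 hθ2 hΓ2 ha2 t x
  rw [hform]
  clear hform
  -- the complex beam slices are differentiable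
  have hFt_diff : DifferentiableAt ℝ (fun τ => a τ * cexp (I * μ * ((θ τ : ℂ)
      + (ξ τ : ℂ) * ((x : ℂ) - X τ) + Γ τ / 2 * ((x : ℂ) - X τ) ^ 2))) t :=
    ((contDiff_beam_t (μ := μ) hX2 hξ2 hθ2 hΓ2 ha2 x).differentiable two_ne_zero) t
  have hFx_diff : DifferentiableAt ℝ (fun y : ℝ => a t * cexp (I * μ * ((θ t : ℂ)
      + (ξ t : ℂ) * ((y : ℂ) - X t) + Γ t / 2 * ((y : ℂ) - X t) ^ 2))) x :=
    ((contDiff_beam_x (μ := μ) hX2 hξ2 hθ2 hΓ2 ha2 t).differentiable two_ne_zero) x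
  -- (A) the main term `χ · Pu`
  have hA : |χ (x - X t) * (iteratedDeriv 2 (fun τ => u τ x) t - iteratedDeriv 2 (u t) x
        + μ ^ 2 * q x * u t x)| ≤ Cχ0' * (Real.sqrt μ * Mstar) := by
    rcases lt_or_ge δ₀ |y| with hfar | hnear
    · rw [hχ0 _ hfar.le, zero_mul, abs_zero]; positivity
    rw [abs_mul]
    refine mul_le_mul (hCχ0 _) ?_ (abs_nonneg _) hCχ0'0
    have hres : iteratedDeriv 2 (fun τ => u τ x) t - iteratedDeriv 2 (u t) x + μ ^ 2 * q x * u t x = _ :=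
      beam_re_residual (μ := μ) hω₀ hX2 hξ2 hθ2 hΓ2 ha2 hX hξ hcons hθ hΓ ha t x
    rw [hres]
    clear hres
    refine (Complex.abs_re_le_norm _).trans ?_
    rw [norm_mul, norm_cexp_beamPhase]
    -- Taylor remainder (in the variable `y = x − X t`)
    have hxy : x - X t = y := rfl
    have hR : |q x - q (X t) - deriv q (X t) * y - iteratedDeriv 2 q (X t) / 2 * y ^ 2|
        ≤ Cq3 * |y| ^ 3 := by
      have h := abs_taylor_two_remainder_le (hq.of_le (by norm_num)) (hLip t ht y hnear)
      rwa [show X t + y = x by rw [hy]; ring] at h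
    have hmain := norm_beam_residual_le hμ hβ hCq30 hR
      (((deriv ξ t : ℝ) : ℂ) - Γ t * ((deriv X t : ℝ) : ℂ)) (deriv Γ t) (a t) (deriv (deriv a) t)
      (2 * (((deriv ξ t : ℝ) : ℂ) - Γ t * ((deriv X t : ℝ) : ℂ)) * deriv a t
        + (((deriv (deriv ξ) t : ℝ) : ℂ) - 2 * deriv Γ t * ((deriv X t : ℝ) : ℂ)
          - Γ t * ((deriv (deriv X) t : ℝ) : ℂ)) * a t)
      (deriv Γ t * deriv a t + deriv (deriv Γ) t / 2 * a t)
    have hyC : ((x : ℂ) - X t) = ((y : ℝ) : ℂ) := by rw [← hxy]; push_cast; ring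
    rw [hyC, hxy]
    refine (le_of_eq rfl).trans (hmain.trans ?_)
    -- bound `M(t)` by the sup-norm majorant
    have nξ1 : ‖((deriv ξ t : ℝ) : ℂ)‖ ≤ Cξ1 := by simpa using hCξ1 t ht
    have nξ2 : ‖((deriv (deriv ξ) t : ℝ) : ℂ)‖ ≤ Cξ2 := by simpa using hCξ2 t ht
    have nX1 : ‖((deriv X t : ℝ) : ℂ)‖ ≤ 1 := by
      rw [Complex.norm_real, Real.norm_eq_abs]; exact hX1 t
    have nX2 : ‖((deriv (deriv X) t : ℝ) : ℂ)‖ ≤ CX2 := by simpa using hCX2 t ht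
    rw [hMstar]
    exact mul_le_mul_of_nonneg_left (beam_majorant_le nξ1 nξ2 nX1 nX2 (hCΓ t ht) (hCΓ1 t ht)
      (hCΓ2 t ht) (hCa t ht) (hCa1 t ht) (hCa2 t ht) hCq30 hβm0 hβm') (Real.sqrt_nonneg μ)
  -- (B) the term `(X′²χ″ − X″χ′ − χ″) u`
  have hu : |u t x| ≤ Ca := by
    show |(a t * cexp (I * μ * ((θ t : ℂ) + (ξ t : ℂ) * ((x : ℂ) - X t)
      + Γ t / 2 * ((x : ℂ) - X t) ^ 2))).re| ≤ Ca
    refine (Complex.abs_re_le_norm _).trans ?_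
    rw [norm_beam_eq]
    have hexp : Real.exp (-(μ * (Γ t).im * (x - X t) ^ 2 / 2)) ≤ 1 := by
      rw [Real.exp_le_one_iff, neg_nonpos]
      have := (hIm t).le
      positivity
    calc ‖a t‖ * Real.exp (-(μ * (Γ t).im * (x - X t) ^ 2 / 2)) ≤ Ca * 1 :=
          mul_le_mul (hCa t ht) hexp (Real.exp_pos _).le hCa0
      _ = Ca := mul_one _
  have hB : |(deriv X t ^ 2 * iteratedDeriv 2 χ (x - X t) - deriv (deriv X) t * deriv χ (x - X t)
        - iteratedDeriv 2 χ (x - X t)) * u t x| ≤ (Cχ2' + CX2 * Cχ1' + Cχ2') * Ca := by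
    rw [abs_mul]
    have hK0 : 0 ≤ Cχ2' + CX2 * Cχ1' + Cχ2' := by positivity
    refine mul_le_mul ?_ hu (abs_nonneg _) hK0
    rw [iteratedDeriv_succ, iteratedDeriv_one]
    have t1 := abs_sub (deriv X t ^ 2 * deriv (deriv χ) (x - X t) - deriv (deriv X) t * deriv χ (x - X t))
      (deriv (deriv χ) (x - X t))
    have t2 := abs_sub (deriv X t ^ 2 * deriv (deriv χ) (x - X t)) (deriv (deriv X) t * deriv χ (x - X t))
    refine t1.trans ((add_le_add t2 le_rfl).trans ?_)
    rw [abs_mul, abs_mul]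
    have i1 : |deriv X t ^ 2| ≤ 1 := by rw [abs_of_nonneg (sq_nonneg _)]; exact hX1sq
    have i2 := hCχ2 (x - X t)
    have i3 := hCχ1 (x - X t)
    have i4 : |deriv (deriv X) t| ≤ CX2 := by simpa [Real.norm_eq_abs] using hCX2 t ht
    have p1 := mul_le_mul i1 i2 (abs_nonneg _) zero_le_one
    have p2 := mul_le_mul i4 i3 (abs_nonneg _) hCX20
    linarith only [p1, p2, i2]
  -- (C), (D) the terms with `χ′`: they live on `δ₀/2 ≤ |y| ≤ δ₀`
  have hann : deriv χ y ≠ 0 → δ₀ / 2 ≤ |y| ∧ |y| ≤ δ₀ := fun h => by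
    by_contra hc
    rw [not_and_or, not_le, not_le] at hc
    exact h (cutoff_derivs_eq_zero hχ1 hχ0 hc).1
  have hoff : δ₀ / 2 ≤ |y| → μ * Gt ≤ 8 / (βm * δ₀ ^ 2) := fun h => by
    have h2 := (gaussian_off_ray_le hμ0 hβm0 hδ₀ h).2
    calc μ * Gt ≤ μ * Real.exp (-(μ * βm * y ^ 2 / 2)) := by gcongr
      _ ≤ 8 / (βm * δ₀ ^ 2) := h2
  have hC : |2 * (deriv X t * deriv χ (x - X t)) * deriv (fun τ => u τ x) t|
      ≤ 2 * Cχ1' * (Ca1 + CΦ * Ca * (8 / (βm * δ₀ ^ 2))) := by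
    rcases eq_or_ne (deriv χ y) 0 with h0 | h0
    · simp only [← hy, h0, mul_zero, zero_mul, abs_zero]; positivity
    obtain ⟨hy1, hy2⟩ := hann h0
    have hd : deriv (fun τ => u τ x) t = (deriv (fun τ => a τ * cexp (I * μ * ((θ τ : ℂ)
        + (ξ τ : ℂ) * ((x : ℂ) - X τ) + Γ τ / 2 * ((x : ℂ) - X τ) ^ 2))) t).re := deriv_re_eq hFt_diff
    rw [hd, abs_mul, abs_mul, abs_mul, abs_two]
    have hut : |(deriv (fun τ => a τ * cexp (I * μ * ((θ τ : ℂ)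
        + (ξ τ : ℂ) * ((x : ℂ) - X τ) + Γ τ / 2 * ((x : ℂ) - X τ) ^ 2))) t).re|
        ≤ Ca1 + CΦ * Ca * (8 / (βm * δ₀ ^ 2)) := by
      refine (Complex.abs_re_le_norm _).trans ?_
      refine (norm_beam_t_le (hX2.of_le (by norm_num)) (hξ2.of_le (by norm_num))
        (hθ2.of_le (by norm_num)) (hΓ2.of_le (by norm_num)) (ha2.of_le (by norm_num)) t x).trans ?_
      have hyC : ((x : ℂ) - X t) = ((y : ℝ) : ℂ) := by rw [hy]; push_cast; ring
      have hΦt : ‖((deriv θ t : ℝ) : ℂ) + ((deriv ξ t : ℝ) : ℂ) * ((x : ℂ) - X t)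
          - (ξ t : ℂ) * ((deriv X t : ℝ) : ℂ) + deriv Γ t / 2 * ((x : ℂ) - X t) ^ 2
          - Γ t * ((x : ℂ) - X t) * ((deriv X t : ℝ) : ℂ)‖ ≤ CΦ := by
        rw [hyC, hCΦ]
        refine beamPhase_t_norm_le (by simpa using hCθ1 t ht) (by simpa using hCξ1 t ht)
          (by simpa using hCξ t ht) ?_ (hCΓ t ht) (hCΓ1 t ht) ?_
        · rw [Complex.norm_real, Real.norm_eq_abs]; exact hX1 t
        · rw [Complex.norm_real, Real.norm_eq_abs]; exact hy2
      have hxy : x - X t = y := rfl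
      rw [hxy, ← hβdef, ← hGt]
      calc (‖deriv a t‖ + |μ| * ‖((deriv θ t : ℝ) : ℂ) + ((deriv ξ t : ℝ) : ℂ) * ((x : ℂ) - X t)
            - (ξ t : ℂ) * ((deriv X t : ℝ) : ℂ) + deriv Γ t / 2 * ((x : ℂ) - X t) ^ 2
            - Γ t * ((x : ℂ) - X t) * ((deriv X t : ℝ) : ℂ)‖ * ‖a t‖) * Gt
          ≤ (Ca1 + μ * CΦ * Ca) * Gt := by
            rw [abs_of_nonneg hμ0]
            refine mul_le_mul_of_nonneg_right ?_ hGt0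
            have i1 := mul_le_mul hΦt (hCa t ht) (norm_nonneg _) hCΦ0
            have i2 := mul_le_mul_of_nonneg_left i1 hμ0
            have i3 := hCa1 t ht
            rw [mul_assoc μ CΦ Ca]
            linarith only [i2, i3]
        _ = Ca1 * Gt + CΦ * Ca * (μ * Gt) := by ring
        _ ≤ Ca1 * 1 + CΦ * Ca * (8 / (βm * δ₀ ^ 2)) := by
            have i2 := mul_le_mul_of_nonneg_left (hoff hy1) (by positivity : 0 ≤ CΦ * Ca)
            have i3 := mul_le_mul_of_nonneg_left hGt1 hCa10
            linarith only [i3, i2]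
        _ = Ca1 + CΦ * Ca * (8 / (βm * δ₀ ^ 2)) := by rw [mul_one]
    have i1 := mul_le_mul (hX1 t) (hCχ1 (x - X t)) (abs_nonneg _) zero_le_one
    have i2 := mul_le_mul i1 hut (abs_nonneg _) (by positivity)
    linarith only [i2]
  have hD : |2 * deriv χ (x - X t) * deriv (u t) x|
      ≤ 2 * Cχ1' * ((Cξ + CΓ * δ₀) * Ca * (8 / (βm * δ₀ ^ 2))) := by
    rcases eq_or_ne (deriv χ y) 0 with h0 | h0
    · simp only [← hy, h0, mul_zero, zero_mul, abs_zero]; positivity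
    obtain ⟨hy1, hy2⟩ := hann h0
    have hd : deriv (u t) x = (deriv (fun y : ℝ => a t * cexp (I * μ * ((θ t : ℂ)
        + (ξ t : ℂ) * ((y : ℂ) - X t) + Γ t / 2 * ((y : ℂ) - X t) ^ 2))) x).re := deriv_re_eq hFx_diff
    rw [hd, abs_mul, abs_mul, abs_two]
    have hux : |(deriv (fun y : ℝ => a t * cexp (I * μ * ((θ t : ℂ)
        + (ξ t : ℂ) * ((y : ℂ) - X t) + Γ t / 2 * ((y : ℂ) - X t) ^ 2))) x).re|
        ≤ (Cξ + CΓ * δ₀) * Ca * (8 / (βm * δ₀ ^ 2)) := by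
      refine (Complex.abs_re_le_norm _).trans ?_
      rw [norm_beam_x_eq]
      have hxy : x - X t = y := rfl
      have hyC : ((x : ℂ) - X t) = ((y : ℝ) : ℂ) := by simp [hy]
      rw [hxy, hyC, ← hβdef, ← hGt, abs_of_nonneg hμ0]
      have hin : ‖(ξ t : ℂ) + Γ t * ((y : ℝ) : ℂ)‖ ≤ Cξ + CΓ * δ₀ := by
        refine (norm_add_le _ _).trans ?_
        gcongr
        · simpa using hCξ t ht
        · rw [norm_mul, Complex.norm_real, Real.norm_eq_abs]
          gcongr; exact hCΓ t ht
      calc μ * ‖(ξ t : ℂ) + Γ t * ((y : ℝ) : ℂ)‖ * ‖a t‖ * Gt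
          = ‖(ξ t : ℂ) + Γ t * ((y : ℝ) : ℂ)‖ * ‖a t‖ * (μ * Gt) := by ring
        _ ≤ (Cξ + CΓ * δ₀) * Ca * (8 / (βm * δ₀ ^ 2)) := by
          have i1 := mul_le_mul hin (hCa t ht) (norm_nonneg _) (by positivity)
          exact mul_le_mul i1 (hoff hy1) (by positivity) (by positivity)
    have i2 := mul_le_mul (hCχ1 (x - X t)) hux (abs_nonneg _) hCχ1'0
    linarith only [i2]
  /- (4) summing up -/
  have hsum : |χ (x - X t) * (iteratedDeriv 2 (fun τ => u τ x) t - iteratedDeriv 2 (u t) x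
          + μ ^ 2 * q x * u t x)
        + (deriv X t ^ 2 * iteratedDeriv 2 χ (x - X t) - deriv (deriv X) t * deriv χ (x - X t)
          - iteratedDeriv 2 χ (x - X t)) * u t x
        - 2 * (deriv X t * deriv χ (x - X t)) * deriv (fun τ => u τ x) t
        - 2 * deriv χ (x - X t) * deriv (u t) x|
      ≤ Cχ0' * (Real.sqrt μ * Mstar) + (Cχ2' + CX2 * Cχ1' + Cχ2') * Ca
        + 2 * Cχ1' * (Ca1 + CΦ * Ca * (8 / (βm * δ₀ ^ 2)))
        + 2 * Cχ1' * ((Cξ + CΓ * δ₀) * Ca * (8 / (βm * δ₀ ^ 2))) := by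
    refine (abs_sub _ _).trans (add_le_add ((abs_sub _ _).trans (add_le_add ?_ hC)) hD)
    exact (abs_add_le _ _).trans (add_le_add hA hB)
  have hE : Cχ0' * (Real.sqrt μ * Mstar) + (Cχ2' + CX2 * Cχ1' + Cχ2') * Ca
        + 2 * Cχ1' * (Ca1 + CΦ * Ca * (8 / (βm * δ₀ ^ 2)))
        + 2 * Cχ1' * ((Cξ + CΓ * δ₀) * Ca * (8 / (βm * δ₀ ^ 2)))
      = Cχ0' * Mstar * Real.sqrt μ + Ccross := by rw [hCcross]; ring
  have hc1 : Ccross ≤ Ccross * Real.sqrt μ := le_mul_of_one_le_right hCcross0 hs1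
  calc _ ≤ _ := hsum
    _ = Cχ0' * Mstar * Real.sqrt μ + Ccross := hE
    _ ≤ (Cχ0' * Mstar + Ccross) * Real.sqrt μ := by linarith only [hc1]

end Pointwise

end Literature.Analysis.PDE
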